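import Mathlib
import HarnessLib
import Literature.MathematicalPhysics.StatisticalMechanics.RenormalisationMapBallABKM

/-!
# The side conditions of `isRGStepQ_abkm` hold for `A` large and then `r` small
# ([ABKM19] Ch. 12: choice of the large-set parameter `A` and of the radius of the ball)

`RGStepABKM.isRGStepQ_abkm` carries four conditions coupling `(r, A)`:
(C1) `v_r ≤ 1/64`, (C2) `ω(r)A² ≤ 1`, (C3) `κ(r)^{L^d}c₃(κ(r)) ≤ A^{η−1}`, (C4) `κ(r)^{L^d}c₂(κ(r)) ≤ A^{η−1}`,
plus `1 ≤ A`, `A_𝒫 ≤ A` and `hsmall : 2^{L^d}A_𝒫A^{−(1−1/η)} ≤ 1`.  Since `κ(r) ≤ κ̄ := 1 + e^{1/4} + 16e^{3/8}·(6/64)`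
whenever `0 ≤ r ≤ 1/64` and `0 ≤ v_r ≤ 1/64`, and the left sides of (C3)–(C4) are monotone in `κ`, the `A`-conditions
hold for ALL admissible `r` once `A` is large; and for fixed `A > 0`, (C1)–(C2) hold for `r` near `0`:

* `kappaBarABKM`, `kappaABKM_le_kappaBar`, `gainConst_mono` (monotonicity in `κ`);
* **`eventually_atTop_sideConditions`** — `∀ᶠ A → ∞`: `1 ≤ A`, `A_𝒫 ≤ A`, `hsmall`, and (C3), (C4) for every
  `r ∈ [0, 1/64]` with `0 ≤ v_r ≤ 1/64`;
* **`eventually_nhds_ballConditions`** — for `A > 0`: `∀ᶠ r → 0`, (C1) and (C2).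

Everything is proved; no named fact.

## References
* S. Adams, S. Buchholz, R. Kotecký, S. Müller, arXiv:1910.13564, proof of Theorem 12.1 (choice of
  parameters), Lemma 10.2 [AdamsBuchholzKoteckyMuller2019].
-/

noncomputable section

namespace Literature.MathematicalPhysics.StatisticalMechanics.GradientRG

open scoped BigOperators Classical Topology
open Filter

/-- `κ̄ = 1 + e^{1/4} + 16e^{3/8}·(6/64)`, a bound for `κ(r)` on the admissible range.
[cite: AdamsBuchholzKoteckyMuller2019, Ch. 12 (12.4)] -/
def kappaBarABKM : ℝ := 1 + Real.exp (1 / 4) + 16 * Real.exp (3 / 8) * (6 / 64)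

/-- `κ(r) ≤ κ̄` for `0 ≤ r ≤ 1/64`, `v_r ≤ 1/64`. [cite: AdamsBuchholzKoteckyMuller2019, Ch. 12 (12.4)] -/
theorem kappaABKM_le_kappaBar {d R : ℕ} {A A𝒫 r : ℝ} (hr : r ≤ 1 / 64)
    (hv : vABKM d R A A𝒫 r ≤ 1 / 64) : kappaABKM d R A A𝒫 r ≤ kappaBarABKM := by
  unfold kappaABKM kappaBarABKM
  have he : 0 ≤ 16 * Real.exp (3 / 8) := by positivity
  nlinarith [he, hr, hv]

/-- `0 ≤ κ(r)` for `0 ≤ r`, `0 ≤ v_r`. [cite: AdamsBuchholzKoteckyMuller2019, Ch. 12 (12.4)] -/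
theorem kappaABKM_nonneg {d R : ℕ} {A A𝒫 r : ℝ} (hr : 0 ≤ r) (hv : 0 ≤ vABKM d R A A𝒫 r) :
    0 ≤ kappaABKM d R A A𝒫 r := by
  unfold kappaABKM; positivity

/-- `0 ≤ v_r` for `r, A_𝒫 ≥ 0`, `A > 0`. [cite: AdamsBuchholzKoteckyMuller2019, Lemma 10.6] -/
theorem vABKM_nonneg {d R : ℕ} {A A𝒫 r : ℝ} (hA : 0 < A) (hA𝒫 : 0 ≤ A𝒫) (hr : 0 ≤ r) :
    0 ≤ vABKM d R A A𝒫 r := by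
  unfold vABKM
  have := pi2BoundConst_nonneg d (show (0 : ℝ) ≤ ((2 * R + 2 : ℕ) : ℝ) + ((d / 2 + 1 : ℕ) : ℝ) by positivity)
  have hAi : 0 ≤ A⁻¹ := inv_nonneg.2 hA.le
  positivity

/-- Monotonicity in `κ` of the block-product constants `κ^{n₁}·((a κ m)^{n} b^{n})`.
[cite: AdamsBuchholzKoteckyMuller2019, Lemma 9.6] -/
theorem gainConst_mono {κ κ' m a b : ℝ} {n₁ n : ℕ} (hκ : 0 ≤ κ) (hκκ' : κ ≤ κ') (hm : 0 ≤ m) (ha : 0 ≤ a)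
    (hb : 0 ≤ b) : κ ^ n₁ * ((a * κ * m) ^ n * b ^ n) ≤ κ' ^ n₁ * ((a * κ' * m) ^ n * b ^ n) := by
  have h1 : 0 ≤ a * κ * m := by positivity
  have h2 : 0 ≤ κ' := hκ.trans hκκ'
  gcongr

/-- **For `A → ∞`: `1 ≤ A`, `A_𝒫 ≤ A`, `hsmall`, and (C3)–(C4) uniformly in the admissible `r`.**
[cite: AdamsBuchholzKoteckyMuller2019, proof of Theorem 12.1] -/
theorem eventually_atTop_sideConditions (d L R : ℕ) (A𝒫 : ℝ) :
    ∀ᶠ A : ℝ in atTop, 1 ≤ A ∧ A𝒫 ≤ A ∧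
      (2 : ℝ) ^ (L ^ d) * (A𝒫 * A ^ (-(1 - (1 + 1 / ((2 * (2 ^ d + 1) + 6 : ℝ) ^ d))⁻¹) : ℝ)) ≤ 1 ∧
      ∀ r : ℝ, 0 ≤ r → r ≤ 1 / 64 → 0 ≤ vABKM d R A A𝒫 r → vABKM d R A A𝒫 r ≤ 1 / 64 →
        (kappaABKM d R A A𝒫 r) ^ (L ^ d) * ((2 * (2 * (kappaABKM d R A A𝒫 r) * max 1 A𝒫)) ^ ((2 ^ (d + 1) + 2) ^ d * L ^ d) * (4 : ℝ) ^ ((2 ^ (d + 1) + 2) ^ d * L ^ d)) ≤ A ^ ((1 + 1 / ((2 * (2 ^ d + 1) + 6 : ℝ) ^ d)) - 1 : ℝ) ∧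
        (kappaABKM d R A A𝒫 r) ^ (L ^ d) * ((2 * (kappaABKM d R A A𝒫 r) * max 1 A𝒫) ^ ((2 ^ (d + 1) + 2) ^ d * L ^ d) * (2 : ℝ) ^ ((2 ^ (d + 1) + 2) ^ d * L ^ d)) ≤ A ^ ((1 + 1 / ((2 * (2 ^ d + 1) + 6 : ℝ) ^ d)) - 1 : ℝ) := by
  have hc : (0 : ℝ) < (2 * (2 ^ d + 1) + 6 : ℝ) ^ d := by positivity
  have hη : 0 < (1 + 1 / ((2 * (2 ^ d + 1) + 6 : ℝ) ^ d)) - 1 := by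
    have e : (1 + 1 / ((2 * (2 ^ d + 1) + 6 : ℝ) ^ d)) - 1 = 1 / ((2 * (2 ^ d + 1) + 6 : ℝ) ^ d) := by ring
    rw [e]; positivity
  have hη' : 0 < 1 - (1 + 1 / ((2 * (2 ^ d + 1) + 6 : ℝ) ^ d))⁻¹ := by
    have e : 1 - (1 + 1 / ((2 * (2 ^ d + 1) + 6 : ℝ) ^ d))⁻¹ = (1 / ((2 * (2 ^ d + 1) + 6 : ℝ) ^ d)) / (1 + 1 / ((2 * (2 ^ d + 1) + 6 : ℝ) ^ d)) := by
      field_simp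
      ring
    rw [e]; positivity
  have hκb : 0 ≤ kappaBarABKM := by unfold kappaBarABKM; positivity
  have hm : 0 ≤ max 1 A𝒫 := le_max_of_le_left zero_le_one
  -- the four `A`-events
  have e1 : ∀ᶠ A : ℝ in atTop, 1 ≤ A := eventually_ge_atTop 1
  have e2 : ∀ᶠ A : ℝ in atTop, A𝒫 ≤ A := eventually_ge_atTop A𝒫
  have e3 : ∀ᶠ A : ℝ in atTop, (2 : ℝ) ^ (L ^ d) * (A𝒫 * A ^ (-(1 - (1 + 1 / ((2 * (2 ^ d + 1) + 6 : ℝ) ^ d))⁻¹) : ℝ)) ≤ 1 := by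
    have h3 : Tendsto (fun A : ℝ => (2 : ℝ) ^ (L ^ d) * (A𝒫 * A ^ (-(1 - (1 + 1 / ((2 * (2 ^ d + 1) + 6 : ℝ) ^ d))⁻¹) : ℝ))) atTop (𝓝 0) := by
      have := ((tendsto_rpow_neg_atTop hη').const_mul A𝒫).const_mul ((2 : ℝ) ^ (L ^ d))
      simpa using this
    exact (h3.eventually (Iic_mem_nhds zero_lt_one))
  have e4 : ∀ᶠ A : ℝ in atTop, kappaBarABKM ^ (L ^ d) * ((2 * (2 * kappaBarABKM * max 1 A𝒫)) ^ ((2 ^ (d + 1) + 2) ^ d * L ^ d) * (4 : ℝ) ^ ((2 ^ (d + 1) + 2) ^ d * L ^ d)) ≤ A ^ ((1 + 1 / ((2 * (2 ^ d + 1) + 6 : ℝ) ^ d)) - 1 : ℝ) :=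
    (tendsto_rpow_atTop hη).eventually_ge_atTop _
  have e5 : ∀ᶠ A : ℝ in atTop, kappaBarABKM ^ (L ^ d) * ((2 * kappaBarABKM * max 1 A𝒫) ^ ((2 ^ (d + 1) + 2) ^ d * L ^ d) * (2 : ℝ) ^ ((2 ^ (d + 1) + 2) ^ d * L ^ d)) ≤ A ^ ((1 + 1 / ((2 * (2 ^ d + 1) + 6 : ℝ) ^ d)) - 1 : ℝ) :=
    (tendsto_rpow_atTop hη).eventually_ge_atTop _
  filter_upwards [e1, e2, e3, e4, e5] with A hA1 hA2 hA3 hA4 hA5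
  refine ⟨hA1, hA2, hA3, fun r hr0 hr hv0 hv => ?_⟩
  have hκ0 : 0 ≤ kappaABKM d R A A𝒫 r := kappaABKM_nonneg hr0 hv0
  have hκ := kappaABKM_le_kappaBar hr hv
  constructor
  · calc (kappaABKM d R A A𝒫 r) ^ (L ^ d) * ((2 * (2 * (kappaABKM d R A A𝒫 r) * max 1 A𝒫)) ^ ((2 ^ (d + 1) + 2) ^ d * L ^ d) * (4 : ℝ) ^ ((2 ^ (d + 1) + 2) ^ d * L ^ d))
        = (kappaABKM d R A A𝒫 r) ^ (L ^ d) * (((2 * 2) * (kappaABKM d R A A𝒫 r) * max 1 A𝒫) ^ ((2 ^ (d + 1) + 2) ^ d * L ^ d) * (4 : ℝ) ^ ((2 ^ (d + 1) + 2) ^ d * L ^ d)) := by ring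
      _ ≤ kappaBarABKM ^ (L ^ d) * (((2 * 2) * kappaBarABKM * max 1 A𝒫) ^ ((2 ^ (d + 1) + 2) ^ d * L ^ d) * (4 : ℝ) ^ ((2 ^ (d + 1) + 2) ^ d * L ^ d)) :=
          gainConst_mono hκ0 hκ hm (by norm_num) (by norm_num)
      _ = kappaBarABKM ^ (L ^ d) * ((2 * (2 * kappaBarABKM * max 1 A𝒫)) ^ ((2 ^ (d + 1) + 2) ^ d * L ^ d) * (4 : ℝ) ^ ((2 ^ (d + 1) + 2) ^ d * L ^ d)) := by ring
      _ ≤ A ^ ((1 + 1 / ((2 * (2 ^ d + 1) + 6 : ℝ) ^ d)) - 1 : ℝ) := hA4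
  · calc (kappaABKM d R A A𝒫 r) ^ (L ^ d) * ((2 * (kappaABKM d R A A𝒫 r) * max 1 A𝒫) ^ ((2 ^ (d + 1) + 2) ^ d * L ^ d) * (2 : ℝ) ^ ((2 ^ (d + 1) + 2) ^ d * L ^ d))
        ≤ kappaBarABKM ^ (L ^ d) * ((2 * kappaBarABKM * max 1 A𝒫) ^ ((2 ^ (d + 1) + 2) ^ d * L ^ d) * (2 : ℝ) ^ ((2 ^ (d + 1) + 2) ^ d * L ^ d)) := gainConst_mono hκ0 hκ hm (by norm_num) (by norm_num)
      _ ≤ A ^ ((1 + 1 / ((2 * (2 ^ d + 1) + 6 : ℝ) ^ d)) - 1 : ℝ) := hA5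

/-- **For `r → 0` at fixed `A > 0`: (C1) `v_r ≤ 1/64` and (C2) `ω(r)A² ≤ 1`.**
[cite: AdamsBuchholzKoteckyMuller2019, proof of Theorem 12.1] -/
theorem eventually_nhds_ballConditions (d R : ℕ) (A A𝒫 : ℝ) :
    ∀ᶠ r : ℝ in 𝓝 0, vABKM d R A A𝒫 r ≤ 1 / 64 ∧ omegaABKM d R A A𝒫 r * A ^ 2 ≤ 1 := by
  have hv : Tendsto (fun r : ℝ => vABKM d R A A𝒫 r) (𝓝 0) (𝓝 0) := by
    have hc : Continuous fun r : ℝ => vABKM d R A A𝒫 r := by unfold vABKM; fun_prop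
    have := hc.tendsto 0
    simpa [vABKM] using this
  have hω : Tendsto (fun r : ℝ => omegaABKM d R A A𝒫 r * A ^ 2) (𝓝 0) (𝓝 0) := by
    have hc : Continuous fun r : ℝ => omegaABKM d R A A𝒫 r * A ^ 2 := by unfold omegaABKM vABKM; fun_prop
    have := hc.tendsto 0
    simpa [omegaABKM, vABKM] using this
  filter_upwards [hv.eventually (Iic_mem_nhds (by norm_num : (0 : ℝ) < 1 / 64)),
    hω.eventually (Iic_mem_nhds zero_lt_one)] with r h1 h2
  exact ⟨h1, h2⟩

end Literature.MathematicalPhysics.StatisticalMechanics.GradientRG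

end
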